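import Literature.Algebra.Lie.LefschetzModule
import HarnessLib

/-!
# `𝔰𝔩₂`-partners are natural: a linear map intertwining `(h, e)` with `(h', e')` intertwines the partners `f`, `f'`
# (Looijenga–Lunts 1997, §1 (1.1): "this `f` is then unique"; André 1996, §1.1: `ᶜΛ` is a formula in `L` and the grading)

Topic `Literature/Algebra/Lie` (namespace `Literature.Algebra.Lie`).  A theorems-only rider on `LefschetzModule.lean`
(A1-88): the partner `f` of a Lefschetz operator `e` on a finite-dimensional `ℤ`-graded space `(M, h)` is not only
UNIQUE (`dualPartner_unique`, `HasLefschetzProperty.eq_dual_of_isSl2Triple`) but NATURAL — every linear map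
`φ : M → M'` with `φ ∘ h = h' ∘ φ` and `φ ∘ e = e' ∘ φ` between two spaces carrying `𝔰𝔩₂`-triples `(h, e, f)`,
`(h', e', f')` satisfies `φ ∘ f = f' ∘ φ` (`comp_dual_eq_dual_comp_of_isSl2Triple`).  For `φ` an isomorphism this is the
uniqueness statement; for `φ` the inclusion of an `(h, e)`-stable subspace carrying its own triple it says that the
subspace is `f`-stable and that `f` restricts to the subspace's partner; for `φ` a pull-back `Θ^*` in cohomology which is
a ring homomorphism preserving degrees it says that `Θ^*` intertwines the dual Lefschetz operators of `ℓ` and `Θ^* ℓ`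
(the use in cell `hodge-kum4`, lane (V), statement V0 `HilbertKummerTransfer`).  No definition, no named fact, no
`sorry`; the commutator Lie ring on `𝔤𝔩(M)` is Mathlib's reducible non-instance `LieRing.ofAssociativeRing`, enabled
file-locally as in `LefschetzModule.lean`.

## Sources

* E. Looijenga, V. A. Lunts, *A Lie algebra attached to a projective variety*, Invent. Math. **129** (1997), §1 (1.1)
  p. 4 L2–L5 (held `paper:arxiv-alg-geom_9604014`): "According to the Jacobson–Morozov lemma this is equivalent to the
  existence of `K`-linear transformation `f` in `M` of degree `-2` such that `[e, f] = h`. This `f` is then unique".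
* Y. André, *Pour une théorie inconditionnelle des motifs*, Publ. Math. IHÉS **83** (1996), §1.1 p. 7 L33–L37 (held
  `paper:doi-10-1007-bf02698643`): `ᶜΛ` is DEFINED on the Lefschetz (primitive) decomposition `x = Σ Lᵏ x_{j-2k}` by
  `ᶜΛ x = Σ k(d − j + k + 1) L^{k−1} x_{j−2k}` — a formula in `L` and the grading alone, hence commuting with every map
  that respects `L` and the grading.
* E. Cattani, App. A of *Hodge Theory* (Math. Notes 49, 2014), Prop. A.3.9 (A.3.5)–(A.3.6): the primitive decomposition
  `V_ℓ = P_ℓ ⊕ N(V_{ℓ-2})`, `P_ℓ = ker N^{ℓ+1}`.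

## Proof

The set `{x | φ (f x) = f' (φ x)}` is a submodule, stable under `e` (because `f e = e f − h`, `f' e' = e' f' − h'` and
`φ` intertwines `e`, `h`), and contains every primitive vector `p ∈ P_{-k} = M_{-k} ∩ ker e^{k+1}` (`f p = 0` by
André's formula `HasLefschetzProperty.dual_apply_primitive`, and `φ p ∈ P'_{-k}` so `f' (φ p) = 0`).  An `e`-stable
submodule containing all the `P_{-k}` is everything (`HasLefschetzProperty.eq_top_of_primitiveSpace_le`): the
non-positive degrees by the primitive decomposition `M_{-k} = P_{-k} + e M_{-k-2}` and descending induction from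
`M_{-k} = 0`, `k ≥ dim M`; the positive degrees as `M_k = e^k M_{-k}`.

## Contents (all proved)

* `HasLefschetzProperty.eq_top_of_primitiveSpace_le` — generation of `M` from the primitive subspaces under `e`;
* `apply_mem_degreeSpace_of_comp_eq`, `apply_mem_primitiveSpace_of_comp_eq` — an `(h, e)`-intertwiner preserves
  degrees and primitivity;
* **`comp_dual_eq_dual_comp_of_isSl2Triple`** — the naturality of the `𝔰𝔩₂`-partner.
-/

noncomputable section

namespace Literature.Algebra.Lie

open Module Function Set

attribute [local instance 100] LieRing.ofAssociativeRing

variable {K : Type*} [Field K] [CharZero K]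
variable {M : Type*} [AddCommGroup M] [Module K M] [FiniteDimensional K M]
variable {M' : Type*} [AddCommGroup M'] [Module K M'] [FiniteDimensional K M']
variable {h e f : Module.End K M} {h' e' f' : Module.End K M'}

/-! ### Generation of `M` by the primitive subspaces under `e` -/

/-- **An `e`-stable submodule containing every primitive subspace `P_{-k}` is all of `M`** (Lefschetz property,
`ℤ`-grading, finite dimension): `M_{-k} = P_{-k} + e·M_{-k-2}` (the primitive decomposition, Cattani (A.3.6)) with
`M_{-k} = 0` for `k ≥ dim M` exhausts the non-positive degrees, and `M_k = e^k M_{-k}` the positive ones.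
[cite: CattaniElZeinGriffithsLe2014, App. A Prop. A.3.9 (A.3.6)] [cite: LooijengaLunts1997, §1 (1.1) p. 4 L1–L2] -/
theorem HasLefschetzProperty.eq_top_of_primitiveSpace_le (L : HasLefschetzProperty h e) (hgr : IsZGrading h)
    {S : Submodule K M} (hS : ∀ x ∈ S, e x ∈ S)
    (hP : ∀ k : ℕ, HasLefschetzProperty.primitiveSpace h e k ≤ S) : S = ⊤ := by
  -- `e^j` preserves `S`
  have hSpow : ∀ (j : ℕ) (x : M), x ∈ S → (e ^ j) x ∈ S := by
    intro j
    induction j with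
    | zero => intro x hx; simpa using hx
    | succ j ih => intro x hx; rw [pow_succ', Module.End.mul_apply]; exact hS _ (ih x hx)
  -- non-positive degrees, by descending induction on `k`
  have hneg : ∀ (n k : ℕ), Module.finrank K M ≤ k + n → degreeSpace h (-(k : ℤ)) ≤ S := by
    intro n
    induction n with
    | zero =>
      intro k hk
      rw [L.degreeSpace_eq_bot (n := -(k : ℤ)) (by rw [abs_neg, Nat.abs_cast]; exact_mod_cast hk)]
      exact bot_le
    | succ n ih =>
      intro k hk x hx
      obtain ⟨x₀, hx₀, y, hy, rfl⟩ := L.exists_primitive_add hx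
      have hy' : y ∈ degreeSpace h (-((k + 2 : ℕ) : ℤ)) := by
        have h1 : (-((k : ℤ) + 2)) = -((k + 2 : ℕ) : ℤ) := by push_cast; ring
        rwa [h1] at hy
      exact S.add_mem (hP k hx₀) (hS y (ih (k + 2) (by omega) hy'))
  have hneg' : ∀ k : ℕ, degreeSpace h (-(k : ℤ)) ≤ S := fun k ↦ hneg (Module.finrank K M) k (by omega)
  -- positive degrees: `M_k = e^k M_{-k}`
  have hpos : ∀ k : ℕ, degreeSpace h (k : ℤ) ≤ S := by
    intro k y hy
    obtain ⟨x, hx, rfl⟩ := (L.bijOn k).surjOn hy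
    exact hSpow k x (hneg' k hx)
  -- all degrees
  rw [eq_top_iff, ← hgr]
  refine iSup_le fun m ↦ ?_
  rcases le_or_gt 0 m with hm | hm
  · have h1 := hpos m.toNat
    rwa [Int.toNat_of_nonneg hm] at h1
  · have h1 := hneg' (-m).toNat
    rwa [Int.toNat_of_nonneg (by omega : (0 : ℤ) ≤ -m), neg_neg] at h1

/-! ### Intertwiners preserve degrees and primitivity -/

omit [CharZero K] [FiniteDimensional K M] [FiniteDimensional K M'] in
/-- A linear map with `φ ∘ h = h' ∘ φ` maps `M_m` into `M'_m`. [cite: LooijengaLunts1997, §1 (1.1) p. 3 ("u has degree k if and only if [h, u] = ku")] -/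
theorem apply_mem_degreeSpace_of_comp_eq (φ : M →ₗ[K] M') (hφh : φ ∘ₗ h = h' ∘ₗ φ) {m : ℤ} {x : M}
    (hx : x ∈ degreeSpace h m) : φ x ∈ degreeSpace h' m := by
  rw [mem_degreeSpace_iff] at hx ⊢
  have h1 := LinearMap.congr_fun hφh x
  simp only [LinearMap.coe_comp, Function.comp_apply] at h1
  rw [← h1, hx, map_smul]

omit [CharZero K] [FiniteDimensional K M] [FiniteDimensional K M'] in
/-- A linear map with `φ ∘ e = e' ∘ φ` satisfies `φ ∘ e^j = e'^j ∘ φ` (iterating the intertwining relation).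
[cite: LooijengaLunts1997, §1 (1.1) p. 4 L1–L2 (the powers e^k)] -/
theorem apply_pow_apply_of_comp_eq (φ : M →ₗ[K] M') (hφe : φ ∘ₗ e = e' ∘ₗ φ) (j : ℕ) (x : M) :
    φ ((e ^ j) x) = (e' ^ j) (φ x) := by
  induction j generalizing x with
  | zero => simp
  | succ j ih =>
    rw [pow_succ, Module.End.mul_apply, ih, pow_succ, Module.End.mul_apply]
    congr 1
    have h1 := LinearMap.congr_fun hφe x
    simpa only [LinearMap.coe_comp, Function.comp_apply] using h1

omit [CharZero K] [FiniteDimensional K M] [FiniteDimensional K M'] in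
/-- A linear map intertwining `(h, e)` with `(h', e')` maps primitive vectors to primitive vectors:
`φ (P_{-k}) ⊆ P'_{-k}` (`P_{-k} = M_{-k} ∩ ker e^{k+1}`). [cite: CattaniElZeinGriffithsLe2014, App. A Prop. A.3.9 (A.3.5)] -/
theorem apply_mem_primitiveSpace_of_comp_eq (φ : M →ₗ[K] M') (hφh : φ ∘ₗ h = h' ∘ₗ φ) (hφe : φ ∘ₗ e = e' ∘ₗ φ)
    {k : ℕ} {p : M} (hp : p ∈ HasLefschetzProperty.primitiveSpace h e k) :
    φ p ∈ HasLefschetzProperty.primitiveSpace h' e' k := by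
  rw [HasLefschetzProperty.mem_primitiveSpace_iff] at hp ⊢
  refine ⟨apply_mem_degreeSpace_of_comp_eq φ hφh hp.1, ?_⟩
  rw [← apply_pow_apply_of_comp_eq φ hφe, hp.2, map_zero]

/-! ### Naturality of the `𝔰𝔩₂`-partner -/

/-- **The `𝔰𝔩₂`-partner is natural.**  Let `(h, e, f)` and `(h', e', f')` be `𝔰𝔩₂`-triples of endomorphisms of
finite-dimensional `ℤ`-graded spaces `(M, h)`, `(M', h')` over a field of characteristic `0`, and let `φ : M → M'` be
linear with `φ ∘ h = h' ∘ φ` and `φ ∘ e = e' ∘ φ`.  Then `φ ∘ f = f' ∘ φ`.  ("This `f` is then unique" is the case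
`φ = id`; André's `ᶜΛ` is a formula in `L` and the grading, which `φ` respects.)  Proof: `f`, `f'` are the constructed
partners (`eq_dual_of_isSl2Triple`); `{x | φ (f x) = f' (φ x)}` is an `e`-stable submodule (`f e = e f − h`) containing
the primitive vectors (`f p = 0`, `φ p` primitive), hence everything (`eq_top_of_primitiveSpace_le`).
[cite: LooijengaLunts1997, §1 (1.1) p. 4 L2–L5] [cite: Andre1996Motifs, §1.1 p. 7 L33–L37 (definition of ᶜΛ on the Lefschetz decomposition)] -/
theorem comp_dual_eq_dual_comp_of_isSl2Triple (hgr : IsZGrading h) (hgr' : IsZGrading h') (t : IsSl2Triple h e f)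
    (t' : IsSl2Triple h' e' f') (φ : M →ₗ[K] M') (hφh : φ ∘ₗ h = h' ∘ₗ φ) (hφe : φ ∘ₗ e = e' ∘ₗ φ) :
    φ ∘ₗ f = f' ∘ₗ φ := by
  have L : HasLefschetzProperty h e := hasLefschetzProperty_of_isSl2Triple hgr t
  have L' : HasLefschetzProperty h' e' := hasLefschetzProperty_of_isSl2Triple hgr' t'
  have hf : f = L.dual hgr := L.eq_dual_of_isSl2Triple hgr t
  have hf' : f' = L'.dual hgr' := L'.eq_dual_of_isSl2Triple hgr' t'
  -- the submodule where the two composites agree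
  set S : Submodule K M := LinearMap.eqLocus (φ ∘ₗ f) (f' ∘ₗ φ) with hSdef
  have hmemS : ∀ x : M, x ∈ S ↔ φ (f x) = f' (φ x) := fun x ↦ by
    simp only [hSdef, LinearMap.mem_eqLocus, LinearMap.coe_comp, Function.comp_apply]
  have hφe_apply : ∀ x, φ (e x) = e' (φ x) := fun x ↦ by
    simpa only [LinearMap.coe_comp, Function.comp_apply] using LinearMap.congr_fun hφe x
  have hφh_apply : ∀ x, φ (h x) = h' (φ x) := fun x ↦ by
    simpa only [LinearMap.coe_comp, Function.comp_apply] using LinearMap.congr_fun hφh x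
  -- `f e = e f - h` on both sides
  have hfe : ∀ x : M, f (e x) = e (f x) - h x := fun x ↦ by
    have h1 := LinearMap.congr_fun t.lie_e_f x
    rw [Ring.lie_def, LinearMap.sub_apply, Module.End.mul_apply, Module.End.mul_apply] at h1
    rw [← h1]; abel
  have hfe' : ∀ y : M', f' (e' y) = e' (f' y) - h' y := fun y ↦ by
    have h1 := LinearMap.congr_fun t'.lie_e_f y
    rw [Ring.lie_def, LinearMap.sub_apply, Module.End.mul_apply, Module.End.mul_apply] at h1
    rw [← h1]; abel
  have hS : ∀ x ∈ S, e x ∈ S := by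
    intro x hx
    rw [hmemS] at hx ⊢
    rw [hfe, map_sub, hφe_apply, hx, hφh_apply, ← hfe', hφe_apply]
  have hP : ∀ k : ℕ, HasLefschetzProperty.primitiveSpace h e k ≤ S := by
    intro k p hp
    rw [hmemS, hf, hf', L.dual_apply_primitive hgr hp, map_zero,
      L'.dual_apply_primitive hgr' (apply_mem_primitiveSpace_of_comp_eq φ hφh hφe hp)]
  have htop : S = ⊤ := L.eq_top_of_primitiveSpace_le hgr hS hP
  refine LinearMap.ext fun x ↦ ?_
  have hx : x ∈ S := by rw [htop]; exact Submodule.mem_top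
  simpa only [LinearMap.coe_comp, Function.comp_apply] using (hmemS x).1 hx

/-- **Corollary (subspaces).**  If `W ≤ M` is stable under `h` and `e`, and the restrictions `(h|_W, e|_W)` complete to
an `𝔰𝔩₂`-triple `(h|_W, e|_W, f_W)`, then `W` is `f`-stable and `f` restricts to `f_W`: `f w = f_W w` for `w ∈ W`.
[cite: LooijengaLunts1997, §1 (1.1) p. 4 L2–L5] -/
theorem apply_eq_of_isSl2Triple_restrict (hgr : IsZGrading h) (t : IsSl2Triple h e f) {W : Submodule K M}
    (hWh : ∀ w ∈ W, h w ∈ W) (hWe : ∀ w ∈ W, e w ∈ W) {fW : Module.End K W}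
    (hgrW : IsZGrading (h.restrict hWh)) (tW : IsSl2Triple (h.restrict hWh) (e.restrict hWe) fW) (w : W) :
    f (w : M) = (fW w : M) := by
  have h1 := comp_dual_eq_dual_comp_of_isSl2Triple hgrW hgr tW t W.subtype
    (by ext x; rfl) (by ext x; rfl)
  have h2 := LinearMap.congr_fun h1 w
  simpa only [LinearMap.coe_comp, Function.comp_apply, Submodule.coe_subtype] using h2.symm

end Literature.Algebra.Lie

end
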